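import Literature.AnabelianGeometry.AbsoluteAnabelian.GaloisLevelRestrictionTheta
import Literature.AnabelianGeometry.AbsoluteAnabelian.GaloisCyclotomeReciprocityFundamental
import Literature.AnabelianGeometry.AbsoluteAnabelian.GaloisCyclotomeRestriction
import HarnessLib

/-!
# The canonical identifications `μ_{ℚ/ℤ}(G_k) ≅ μ(k̄)` are compatible with restriction to a finite
# extension ([AbsAnab] Prop. 1.2.1 (vi)/(vii); [AbsTopIII] Cor. 1.10 (i), Rmk. 1.10.1 (iii))

abc-iut cell, layer L4, row «COR110ib-OPEN» file F3 (abc-iut-L4-t11).  For a finite extension `E/F` of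
MLFs (characteristic `0`) and torsion reciprocity data `D_F`, `D_E` CHARACTERISED at every realised finite
level (the clause of abc-iut-L6-t11's `exists_torsionReciprocityData_levelChar` — the data of the natural
family of [AbsTopIII] Cor. 1.10 (i)(b), abc-iut-L4-d3):

* `toMul_muLift_restrict_of_levelChar` — **`ι (D_F.muLift z) = D_E.muLift (μ_{ℚ/ℤ}(res)⁻¹ z)`** for every
  `z ∈ μ_{ℚ/ℤ}(G_F)` (`res : G_E ↪ G_F`, `ι : F̄ ≅ Ē`): represent `z` at a finite Galois level `L ⊆ F̄`
  containing `E₀` (`muQZ.of_verlagerung`), read both sides through level packages at `L` and at its copy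
  `ι(L) ⊆ Ē` (`levelChar`; `muQZ.mapOfOpenEmbedding` on representatives), and compare the packages
  (`Cor110Open.level_package_transport`);
* `equiv_restrict_compat` — the same for `D.equiv`, in the `hcompat` shape consumed by
  `reciprocityIso_galCyclotomeRes` (`ReconstructionCor110OpenFunctoriality.lean`).

Proof-only; universe `0`.  HONEST FRAMING: classical local class field theory; nothing here bears on
[IUTchIII] Cor. 3.12.
-/

noncomputable section

open Field IntermediateField ValuativeRel
open scoped Pointwise

namespace Literature.AnabelianGeometry.AbsoluteAnabelian

open Literature.NumberTheory.GaloisRepresentations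
open Literature.NumberTheory.GaloisRepresentations.LocalWeilDatum
open Literature.AlgebraicGeometry.Frobenioids.PadicKummer

namespace Cor110Open

section Compat

variable (F E : Type) [Field F] [CharZero F] [Field E] [Algebra F E] [FiniteDimensional F E]

/-! ### Torsion classes along `liftGal F E` at a Galois level -/

/-- At a finite Galois level `L ⊇ E₀` of `F`: the class `[liftGal F E h]` in `Gal(Ē/ι(L))^ab` of the lift
of `h ∈ Gal(F̄/L)` is torsion when `[h] ∈ Gal(F̄/L)^ab` is (transport along
`Gal(F̄/L) ≅ Γ_L ≅ Γ_{ι(L)} ≅ Gal(Ē/ι(L))`). [cite: MochizukiAbsAnab2004, Prop 1.2.1 (vii) p.11] -/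
theorem exists_torsion_liftGal (L : IntermediateField F (AlgebraicClosure F)) [FiniteDimensional F L]
    [IsGalois F L] (hEL : embField F E ≤ L) [FiniteDimensional E (extField F E L hEL)]
    {h : absoluteGaloisGroup F} (hhL : h ∈ galFixing F L) (hhL' : h ∈ galFixing F (embField F L))
    (ht : QuotientGroup.mk (⟨h, hhL'⟩ : galFixing F (embField F L)) ∈
      abelianizationTorsion (galFixing F (embField F L))) :
    QuotientGroup.mk (⟨liftGal F E (galFixing_level_le F E L hEL hhL),
        liftGal_mem_galFixing_embField_extField F E L hEL hhL⟩ :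
        galFixing E (embField E (extField F E L hEL))) ∈
      abelianizationTorsion (galFixing E (embField E (extField F E L hEL))) := by
  classical
  obtain ⟨σ, σl, hσ, -, hb, -⟩ := exists_levelFieldIso F E L hEL
  obtain ⟨ΦF, hΦF⟩ := exists_continuousMulEquiv_galFixing_embField F L
  obtain ⟨êF, hêF⟩ := exists_mulEquiv_topologicalAbelianization ΦF
  obtain ⟨ΦE, hΦE⟩ := exists_continuousMulEquiv_galFixing_embField E (extField F E L hEL)
  obtain ⟨êE, hêE⟩ := exists_mulEquiv_topologicalAbelianization ΦE
  let φ : TopologicalAbelianization (galFixing F (embField F L)) →*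
      TopologicalAbelianization (galFixing E (embField E (extField F E L hEL))) :=
    êE.symm.toMonoidHom.comp ((abelianizationCongr (galConjₜ σ σl hσ)).toMonoidHom.comp êF.toMonoidHom)
  have hφ : φ (QuotientGroup.mk ⟨h, hhL'⟩) =
      QuotientGroup.mk ⟨liftGal F E (galFixing_level_le F E L hEL hhL),
        liftGal_mem_galFixing_embField_extField F E L hEL hhL⟩ := by
    change êE.symm (abelianizationCongr (galConjₜ σ σl hσ) (êF (QuotientGroup.mk ⟨h, hhL'⟩))) = _
    rw [MulEquiv.symm_apply_eq, hêF, hΦF, abelianizationCongr_mk, galConjₜ_apply, hêE, hΦE]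
    change _ = (QuotientGroup.mk (liftGal E (extField F E L hEL) _) : _)
    rw [hb h hhL hhL']
  rw [CommGroup.mem_torsion] at ht ⊢
  rw [← hφ]
  exact φ.isOfFinOrder ht

/-! ### `μ_{ℚ/ℤ}(res)` on representatives at a Galois level -/

/-- **`μ_{ℚ/ℤ}(res)` on representatives**: for a finite Galois level `L ⊇ E₀`, `h ∈ Gal(F̄/L)` with torsion
class, `μ_{ℚ/ℤ}(res)` sends the class of `liftGal F E h ∈ Gal(Ē/ι(L))` to the class of `h ∈ Gal(F̄/L)`
(`muQZ.mapOfOpenEmbedding` = transport along `G_E ≅ res(G_E)` then the open-subgroup comparison,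
both explicit on representatives). [cite: MochizukiAbsAnab2004, Prop 1.2.1 (vii) p.11] -/
theorem mapOfOpenEmbedding_ofRep_liftGal [CharZero E] (L : IntermediateField F (AlgebraicClosure F))
    [FiniteDimensional F L] [IsGalois F L] (hEL : embField F E ≤ L)
    (V' : OpenSubgroup (absoluteGaloisGroup E)) (hV' : (V' : Subgroup (absoluteGaloisGroup E)) =
      galFixing E (extField F E L hEL))
    (VL : OpenSubgroup (absoluteGaloisGroup F)) (hVL : (VL : Subgroup (absoluteGaloisGroup F)) = galFixing F L)
    {h : absoluteGaloisGroup F} (hhL : h ∈ galFixing F L) (hhV : h ∈ VL)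
    (hh'V : liftGal F E (galFixing_level_le F E L hEL hhL) ∈ V') (ht') (ht) :
    muQZ.mapOfOpenEmbedding (absGaloisRestrict F E) (absGaloisRestrict_injective F E)
        (isOpen_range_absGaloisRestrict F E)
        (muQZ.ofRep V' (liftGal F E (galFixing_level_le F E L hEL hhL)) hh'V ht') =
      muQZ.ofRep VL h hhV ht := by
  set f := absGaloisRestrict F E
  set hinj := absGaloisRestrict_injective F E
  set hf := isOpen_range_absGaloisRestrict F E
  change muQZ.restrictOpen (rangeOpenSubgroup f hf)
      (muQZ.map (equivRangeOfInjective f hinj hf) (muQZ.ofRep V' _ hh'V ht')) = _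
  rw [muQZ.map_ofRep, muQZ.restrictOpen_ofRep]
  refine muQZ.ofRep_congr ?_ ?_
  · -- `(e V')† = V_L`
    ext g
    rw [mem_osMap_iff]
    constructor
    · rintro ⟨hg, hgV⟩
      change (equivRangeOfInjective f hinj hf).symm ⟨g, hg⟩ ∈ (V' : Subgroup (absoluteGaloisGroup E)) at hgV
      rw [hV', mem_galFixing_iff] at hgV
      have hs : f ((equivRangeOfInjective f hinj hf).symm ⟨g, hg⟩) = g :=
        congrArg Subtype.val ((equivRangeOfInjective f hinj hf).apply_symm_apply ⟨g, hg⟩)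
      change g ∈ (VL : Subgroup (absoluteGaloisGroup F))
      rw [hVL, mem_galFixing_iff]
      intro a ha
      rw [← hs]
      apply (absClosureEmbedding F E).injective
      change absClosureEmbedding F E (absGaloisRestrict F E _ • a) = absClosureEmbedding F E a
      rw [absGaloisRestrict_apply_smul]
      exact hgV _ ((absClosureEmbedding_mem_extField_iff F E hEL).mpr ha)
    · intro hgV
      change g ∈ (VL : Subgroup (absoluteGaloisGroup F)) at hgV
      rw [hVL] at hgV
      have hg : g ∈ (rangeOpenSubgroup f hf : Subgroup (absoluteGaloisGroup F)) :=
        ⟨liftGal F E (galFixing_level_le F E L hEL hgV), absGaloisRestrict_liftGal F E _⟩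
      refine ⟨hg, ?_⟩
      change (equivRangeOfInjective f hinj hf).symm ⟨g, hg⟩ ∈ (V' : Subgroup (absoluteGaloisGroup E))
      have hs : (equivRangeOfInjective f hinj hf).symm ⟨g, hg⟩ =
          liftGal F E (galFixing_level_le F E L hEL hgV) :=
        (equivRangeOfInjective f hinj hf).injective (by
          rw [ContinuousMulEquiv.apply_symm_apply]
          exact Subtype.ext (absGaloisRestrict_liftGal F E _).symm)
      rw [hs, hV']
      exact liftGal_mem_galFixing_extField F E L hEL hgV
  · -- `res (liftGal h) = h`
    exact absGaloisRestrict_liftGal F E _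

end Compat

section Main

variable (F E : Type) [Field F] [ValuativeRel F] [TopologicalSpace F] [IsNonarchimedeanLocalField F]
  [CharZero F] [Field E] [ValuativeRel E] [TopologicalSpace E] [IsNonarchimedeanLocalField E] [CharZero E]
  [Algebra F E] [FiniteDimensional F E] [ValuativeExtension F E]

/-- **The fundamental identifications `μ_{ℚ/ℤ}(G_k) → k̄ˣ` are compatible with restriction** ([AbsAnab]
Prop. 1.2.1 (vi)/(vii) for the open injection `res : G_E ↪ G_F` of a finite extension `E/F` of MLFs;
[AbsTopIII] Cor. 1.10 (i)(b), Rmk. 1.10.1 (iii)): for FUNDAMENTAL (= local-class-field-theory normalised)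
torsion reciprocity data `D_F`, `D_E`, and every `z ∈ μ_{ℚ/ℤ}(G_F)`,
`D_E.muLift (μ_{ℚ/ℤ}(res)⁻¹ z) = ι (D_F.muLift z)` in `Ē`, `ι : F̄ → Ē` the chosen embedding.  Proof: represent
`z` at a finite Galois level `L ⊇ E₀` (Verlagerung-invariance of the direct limit), evaluate both data through
level packages at `L` (base `F`) and at `ι(L)` (base `E`) — the normalisation clause `IsFundamental` — and
compare the two packages along `ι` (`Cor110Open.level_package_transport`: Serre's `θ` of the level field does
not depend on the base). [cite: MochizukiAbsAnab2004, Prop 1.2.1 (vi) p.10] -/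
theorem toMul_muLift_restrict_of_isFundamental {DF : TorsionReciprocityData F}
    {DE : TorsionReciprocityData E} (hDF : DF.IsFundamental) (hDE : DE.IsFundamental)
    (z : muQZ (absoluteGaloisGroup F)) :
    ((Additive.toMul (DE.muLift ((muQZ.mapOfOpenEmbedding (absGaloisRestrict F E)
        (absGaloisRestrict_injective F E) (isOpen_range_absGaloisRestrict F E)).symm z)) :
        (AlgebraicClosure E)ˣ) : AlgebraicClosure E) =
      absClosureEmbedding F E
        ((Additive.toMul (DF.muLift z) : (AlgebraicClosure F)ˣ) : AlgebraicClosure F) := by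
  classical
  obtain ⟨U, x, rfl⟩ := muQZ.exists_of z
  -- a finite Galois level `L ⊇ E₀` with `Gal(F̄/L) ⊆ U`
  haveI := finiteDimensional_embField F E
  obtain ⟨L, hLfin, hLgal, hLsub⟩ := exists_finiteDimensional_isGalois_galFixing_subset (k := F)
    ((U.isOpen.inter (isOpen_galFixing F (embField F E))).mem_nhds ⟨U.one_mem, Subgroup.one_mem _⟩)
  haveI := hLfin
  haveI := hLgal
  have hEL : embField F E ≤ L := le_of_galFixing_le fun g hg => (hLsub hg).2
  let VL : OpenSubgroup (absoluteGaloisGroup F) := ⟨galFixing F L, isOpen_galFixing F L⟩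
  have hVU : VL ≤ U := fun g hg => (hLsub hg).1
  -- move the class down to the level `L` (Verlagerung-invariance of the direct limit)
  rw [← muQZ.of_verlagerung hVU x]
  set s := verlagerungTorsion U.isOpen VL.isOpen (OpenSubgroup.toSubgroup_le.mpr hVU) x with hs_def
  clear_value s
  obtain ⟨v, hv⟩ := QuotientGroup.mk_surjective
    (s.1 : TopologicalAbelianization (VL : Subgroup (absoluteGaloisGroup F)))
  have hvL : (v : absoluteGaloisGroup F) ∈ galFixing F L := v.2
  -- the level package at `L` (base `F`) and the normalisation clause for `D_F`
  have hLL : embField F L = L := embField_coe_eq_self L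
  have hGal : galFixing F (embField F L) = galFixing F L := by rw [hLL]
  have hvL' : (v : absoluteGaloisGroup F) ∈ galFixing F (embField F L) := hGal ▸ hvL
  have hMo : IsOpen (galFixing F (embField F L) : Set (absoluteGaloisGroup F)) := by
    rw [hGal]; exact isOpen_galFixing F L
  have hMU : galFixing F (embField F L) ≤ (VL : Subgroup (absoluteGaloisGroup F)) := hGal.le
  obtain ⟨ArtL, θL, -, htorsL, hcharL, hθL⟩ := exists_levelReciprocity F L
  have hF := hDF VL L ArtL θL htorsL hcharL hθL hMo hMU s
  set xF := verlagerungTorsion VL.isOpen hMo hMU s with hxF_def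
  have hx : (xF : TopologicalAbelianization (galFixing F (embField F L))) =
      QuotientGroup.mk ⟨(v : absoluteGaloisGroup F), hvL'⟩ :=
    coe_verlagerungTorsion_congr_right hGal.symm VL.isOpen VL.isOpen hMo le_rfl hMU s v
      (by rw [verlagerungTorsion_refl]; exact hv.symm)
  have htF : QuotientGroup.mk (⟨(v : absoluteGaloisGroup F), hvL'⟩ : galFixing F (embField F L)) ∈
      abelianizationTorsion (galFixing F (embField F L)) := hx ▸ xF.2
  -- the level `ι(L)` of `E`, its package, and the normalisation clause for `D_E`
  haveI := finiteDimensional_extField F E L hEL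
  haveI := finiteDimensional_embField E (extField F E L hEL)
  let V' : OpenSubgroup (absoluteGaloisGroup E) :=
    ⟨galFixing E (embField E (extField F E L hEL)), isOpen_galFixing E _⟩
  have hV' : (V' : Subgroup (absoluteGaloisGroup E)) = galFixing E (extField F E L hEL) := by
    change galFixing E (embField E (extField F E L hEL)) = _
    rw [embField_extField_eq F E L hEL]
  have hh'V : liftGal F E (galFixing_level_le F E L hEL hvL) ∈ V' :=
    liftGal_mem_galFixing_embField_extField F E L hEL hvL
  have ht' := exists_torsion_liftGal F E L hEL hvL hvL' htF
  have htVL : QuotientGroup.mk (⟨(v : absoluteGaloisGroup F), hvL⟩ : (VL : Subgroup _)) ∈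
      abelianizationTorsion (VL : Subgroup (absoluteGaloisGroup F)) := by
    rw [Subtype.coe_eta, hv]; exact s.2
  have hres : (muQZ.mapOfOpenEmbedding (absGaloisRestrict F E) (absGaloisRestrict_injective F E)
      (isOpen_range_absGaloisRestrict F E)).symm (muQZ.of VL (Additive.ofMul s)) =
      muQZ.ofRep V' _ hh'V ht' := by
    rw [AddEquiv.symm_apply_eq, mapOfOpenEmbedding_ofRep_liftGal F E L hEL V' hV' VL rfl hvL hvL hh'V
      ht' htVL]
    change muQZ.of VL _ = muQZ.of VL _
    congr 2
    exact Subtype.ext hv.symm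
  rw [hres]
  obtain ⟨ArtM, θM, -, htorsM, hcharM, hθM⟩ := exists_levelReciprocity E (extField F E L hEL)
  let s' : abelianizationTorsion (V' : Subgroup (absoluteGaloisGroup E)) := ⟨_, ht'⟩
  have hE := hDE V' (extField F E L hEL) ArtM θM htorsM hcharM hθM V'.isOpen le_rfl s'
  rw [verlagerungTorsion_refl] at hE
  change ((Additive.toMul (DE.muLift (muQZ.of V' (Additive.ofMul s'))) : (AlgebraicClosure E)ˣ) :
    AlgebraicClosure E) = _
  rw [TorsionReciprocityData.muLift_of, TorsionReciprocityData.muLift_of, toMul_ofMul, toMul_ofMul, hE,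
    hF]
  exact level_package_transport F E L hEL ArtL θL htorsL hcharL hθL ArtM θM hcharM hθM v hvL hvL' xF hx
    s' rfl

/-- **Restriction-compatibility in the `hcompat` shape** consumed by `reciprocityIso_galCyclotomeRes`
(`ReconstructionCor110OpenFunctoriality.lean`): for fundamental data, the identifications
`D.equiv : μ_{ℚ/ℤ}(G_k) ≃ (k̄ˣ)_tors` of `F` and of `E` correspond under `μ_{ℚ/ℤ}(res)⁻¹` and `ι : F̄ → Ē`.
[cite: MochizukiAbsAnab2004, Prop 1.2.1 (vi) p.10] -/
theorem equiv_restrict_compat {DF : TorsionReciprocityData F} {DE : TorsionReciprocityData E}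
    (hDF : DF.IsFundamental) (hDE : DE.IsFundamental) (z : muQZ (absoluteGaloisGroup F)) :
    (((Additive.toMul (DE.equiv ((muQZ.mapOfOpenEmbedding (absGaloisRestrict F E)
        (absGaloisRestrict_injective F E) (isOpen_range_absGaloisRestrict F E)).symm z)) :
        CommGroup.torsion (AlgebraicClosure E)ˣ) : (AlgebraicClosure E)ˣ) : AlgebraicClosure E) =
      absClosureEmbedding F E ((((Additive.toMul (DF.equiv z)) :
        CommGroup.torsion (AlgebraicClosure F)ˣ) : (AlgebraicClosure F)ˣ) : AlgebraicClosure F) :=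
  toMul_muLift_restrict_of_isFundamental F E hDF hDE z

/-- The same for THE fundamental data `fundamental F`, `fundamental E`
(`GaloisCyclotomeReciprocityFundamental.lean`). [cite: MochizukiAbsAnab2004, Prop 1.2.1 (vi) p.10] -/
theorem fundamental_equiv_restrict_compat (z : muQZ (absoluteGaloisGroup F)) :
    (((Additive.toMul ((TorsionReciprocityData.fundamental E).equiv
        ((muQZ.mapOfOpenEmbedding (absGaloisRestrict F E)
        (absGaloisRestrict_injective F E) (isOpen_range_absGaloisRestrict F E)).symm z)) :
        CommGroup.torsion (AlgebraicClosure E)ˣ) : (AlgebraicClosure E)ˣ) : AlgebraicClosure E) =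
      absClosureEmbedding F E ((((Additive.toMul ((TorsionReciprocityData.fundamental F).equiv z)) :
        CommGroup.torsion (AlgebraicClosure F)ˣ) : (AlgebraicClosure F)ˣ) : AlgebraicClosure F) :=
  equiv_restrict_compat F E (TorsionReciprocityData.fundamental_isFundamental F)
    (TorsionReciprocityData.fundamental_isFundamental E) z

end Main

end Cor110Open

end Literature.AnabelianGeometry.AbsoluteAnabelian
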